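import Mathlib
import Literature.Computability.AlgebraicComplexity.SymmetricArithCircuit
import Literature.Computability.AlgebraicComplexity.SymmetricCircuitConstOutputs
import Summits.ValiantsHypothesis.ValiantsHypothesis.Theses.ProofCarryingSymmetry

/-! Strategist r1 scratch (crux `RestorationQP`, stmt-ValiantsHypothesis-10343): the typed content of
STRATEGY-CENSUS.md (r1) — the DIVISION reading of the crux.

* `NoNameLift` (A, claimed theorem, not filed): every diagonally invariant VP family becomes
  symmetrically computable at POLYNOMIAL cost after multiplication by a power of the diagonal
  discriminant `diagDisc n = ∏_{i ≠ j} (x_ii - x_jj)` (no-name-lemma descent through the separating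
  invariants `e_k(diag x)`, `W_{a,b} = Σ_{i≠j} x_ii^a x_jj^b x_ij` + Bläser–Jindal Newton lifting).
* `SymDivDiag` (B): symmetric exact division by that discriminant power.  `NoNameLift → SymDivDiag →
  RestorationQP` and `RestorationQP → SymDivDiag` are pure logic, so modulo (A) the crux IS (B).
* `UnitDenominatorQP` (B′): the Strassen form — a denominator that is a unit at a point fixed by a
  subgroup of quasi-polynomial index; `RestorationQP → UnitDenominatorQP` (q = 1) proved here, the
  converse is symmetric Strassen division elimination (`SymmetricStrassen`, provable, not filed).
* `diagDisc_eval_eq_zero_of_fixed`: the (A)-denominator is NEVER such a unit — it vanishes at every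
  point fixed by any permutation group moving an index (kernel-checked tightness of the transfer).
Nothing here is an item; nothing is sorried. -/

set_option linter.dupNamespace false

open Literature.Computability.AlgebraicComplexity

namespace Summit.ValiantsHypothesis.ValiantsHypothesis.Cruxes.RestorationQP.DivisionCensus

/-- `HasSymCircuit n g s`: some `S_n`-symmetric labelled circuit with at most `s` gates computes `g`
(the conclusion shape of `RestorationQP`, named). -/
def HasSymCircuit (n : ℕ) (g : MvPolynomial (Fin n × Fin n) ℂ) (s : ℕ) : Prop :=
  ∃ (G : Type) (_ : Fintype G) (C : LabelledArithCircuit ℂ (Fin n × Fin n) Unit G),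
    C.IsSymmetric (Equiv.Perm (Fin n)) ∧ C.eval (C.output ()) = g ∧ Fintype.card G ≤ s

/-- Diagonal (`x_ij ↦ x_{σ i σ j}`) invariance of a family (the hypothesis shape of `RestorationQP`). -/
def IsDiagInvariant (f : (n : ℕ) → MvPolynomial (Fin n × Fin n) ℂ) : Prop :=
  ∀ (n : ℕ) (σ : Equiv.Perm (Fin n)),
    MvPolynomial.rename (fun x : Fin n × Fin n => σ • x) (f n) = f n

/-- The quasi-polynomial budget of the route, `2 ^ ((log₂ n + c) ^ c)`. -/
def qp (c n : ℕ) : ℕ := 2 ^ ((Nat.log 2 n + c) ^ c)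

/-- The crux, unfolded into the named shapes (definitional). -/
theorem restorationQP_iff :
    Summit.ValiantsHypothesis.ValiantsHypothesis.Theses.ProofCarryingSymmetry.RestorationQP ↔
      ∀ f, IsDiagInvariant f → IsVPFamily f → ∃ c : ℕ, ∀ n : ℕ, HasSymCircuit n (f n) (qp c n) :=
  Iff.rfl

/-- The ORDERED diagonal discriminant `∏_{i ≠ j} (x_ii - x_jj)` (`= ± Vandermonde(diag x)²`; it is
`S_n`-invariant and has an `S_n`-symmetric circuit with `O(n²)` gates). -/
noncomputable def diagDisc (n : ℕ) : MvPolynomial (Fin n × Fin n) ℂ :=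
  ∏ p ∈ (Finset.univ.filter fun p : Fin n × Fin n => p.1 ≠ p.2),
    (MvPolynomial.X (p.1, p.1) - MvPolynomial.X (p.2, p.2))

/-- (A) NO-NAME LIFT — restoration holds at POLYNOMIAL cost after multiplying by a power of the
diagonal discriminant (equivalently: with ONE exact division).  Claimed theorem (census §Transfer):
`ℂ(Mat_n)^{S_n} = ℂ(e_•(diag), W_{•,•})`, `f · det M(diag)^{2D} = P(e, W)` with `L(P) ≤ poly`
(Bläser–Jindal 2019 Newton lifting with parameters), `det M(diag) = ± Vdm(diag)^{2n-3}`. -/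
def NoNameLift : Prop :=
  ∀ f, IsDiagInvariant f → IsVPFamily f →
    ∃ c : ℕ, ∀ n : ℕ, ∃ m : ℕ, m ≤ (n + 2) ^ c ∧
      HasSymCircuit n (f n * diagDisc n ^ m) ((n + 2) ^ c)

/-- (B) SYMMETRIC DIVISION BY THE DIAGONAL DISCRIMINANT: if `f · diagDisc^m` (poly `m`) has
polynomial-size symmetric circuits then `f` has quasi-polynomial-size symmetric circuits. -/
def SymDivDiag : Prop :=
  ∀ f, IsDiagInvariant f → IsVPFamily f →
    (∃ c : ℕ, ∀ n : ℕ, ∃ m : ℕ, m ≤ (n + 2) ^ c ∧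
      HasSymCircuit n (f n * diagDisc n ^ m) ((n + 2) ^ c)) →
    ∃ c : ℕ, ∀ n : ℕ, HasSymCircuit n (f n) (qp c n)

/-- The division cut reassembles the crux (modus ponens). -/
theorem restorationQP_of_noNameLift_symDivDiag (hA : NoNameLift) (hB : SymDivDiag) :
    Summit.ValiantsHypothesis.ValiantsHypothesis.Theses.ProofCarryingSymmetry.RestorationQP :=
  fun f hf hVP => hB f hf hVP (hA f hf hVP)

/-- … and the crux gives piece (B) outright (ignore the division hypothesis): modulo the theorem (A)
the crux IS symmetric division by the diagonal discriminant — piece (B) is not weaker than `C`. -/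
theorem symDivDiag_of_restorationQP
    (h : Summit.ValiantsHypothesis.ValiantsHypothesis.Theses.ProofCarryingSymmetry.RestorationQP) :
    SymDivDiag :=
  fun f hf hVP _ => h f hf hVP

/-- (B′) UNIT-DENOMINATOR FORM.  For every invariant VP family: an invariant denominator `q` with
quasi-polynomial symmetric circuits for `q` and `f · q`, which is a UNIT at some point `a` fixed by a
subgroup `Γ ≤ S_n` of quasi-polynomial index (the base point symmetric Strassen needs). -/
def UnitDenominatorQP : Prop :=
  ∀ f, IsDiagInvariant f → IsVPFamily f →
    ∃ c : ℕ, ∀ n : ℕ, ∃ (q : MvPolynomial (Fin n × Fin n) ℂ) (Γ : Subgroup (Equiv.Perm (Fin n)))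
      (a : Fin n × Fin n → ℂ),
      Γ.index ≤ qp c n ∧ (∀ σ ∈ Γ, ∀ x, a (σ • x) = a x) ∧ MvPolynomial.eval a q ≠ 0 ∧
      HasSymCircuit n q (qp c n) ∧ HasSymCircuit n (f n * q) (qp c n)

/-- SYMMETRIC STRASSEN (the converse of `unitDenominatorQP_of_restorationQP`; provable by Strassen's
division elimination at the `Γ`-fixed base point — shift `x ↦ x + a`, geometric series for `1/q`,
homogeneous truncation by the scaling interpolation `x ↦ λx`, then symmetrisation over `S_n/Γ` — all
gate-permutation-equivariant; recorded, not filed). -/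
def SymmetricStrassen : Prop :=
  UnitDenominatorQP →
    Summit.ValiantsHypothesis.ValiantsHypothesis.Theses.ProofCarryingSymmetry.RestorationQP

theorem two_le_qp (c n : ℕ) : 2 ≤ qp c n := by
  unfold qp
  rcases Nat.eq_zero_or_pos c with rfl | hc
  · simp
  · calc (2 : ℕ) = 2 ^ 1 := by norm_num
      _ ≤ 2 ^ ((Nat.log 2 n + c) ^ c) :=
        Nat.pow_le_pow_right (by norm_num) (Nat.one_le_pow _ _ (by omega))

/-- `C → (B′)` with the trivial denominator `q = 1`, `Γ = ⊤`, `a = 0`. -/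
theorem unitDenominatorQP_of_restorationQP
    (h : Summit.ValiantsHypothesis.ValiantsHypothesis.Theses.ProofCarryingSymmetry.RestorationQP) :
    UnitDenominatorQP := by
  intro f hf hVP
  obtain ⟨c, hc⟩ := h f hf hVP
  refine ⟨c, fun n => ⟨1, ⊤, fun _ => 0, ?_, ?_, ?_, ?_, ?_⟩⟩
  · simp only [Subgroup.index_top]
    exact Nat.one_le_two_pow
  · intro σ _ x
    rfl
  · simp
  · obtain ⟨G, hG, C, hsym, hev, hcard⟩ :=
      LabelledArithCircuit.exists_constOutputs (K := ℂ) (Fin n × Fin n) (Y := Unit)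
        (Γ := Equiv.Perm (Fin n)) (fun _ => (1 : ℂ)) (fun _ _ => rfl)
    refine ⟨G, hG, C, hsym, by simpa using hev (), ?_⟩
    exact hcard.trans (by simpa using two_le_qp c n)
  · simpa only [HasSymCircuit, qp, mul_one] using hc n

/-- TIGHTNESS OF THE TRANSFER: the no-name denominator is never a Strassen unit — `diagDisc n`
vanishes at every point fixed by a permutation group that moves some index (in particular at every
`S_n`-fixed point `αI + β(J - I)`, and at every point fixed by a subgroup of sub-factorial index). -/
theorem diagDisc_eval_eq_zero_of_fixed {n : ℕ} (Γ : Subgroup (Equiv.Perm (Fin n)))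
    (a : Fin n × Fin n → ℂ) (ha : ∀ σ ∈ Γ, ∀ x, a (σ • x) = a x)
    (hmove : ∃ σ ∈ Γ, ∃ i : Fin n, σ i ≠ i) :
    MvPolynomial.eval a (diagDisc n) = 0 := by
  obtain ⟨σ, hσ, i, hi⟩ := hmove
  unfold diagDisc
  rw [map_prod]
  apply Finset.prod_eq_zero (i := (σ i, i))
  · simp [hi]
  · have h := ha σ hσ (i, i)
    have h' : σ • ((i, i) : Fin n × Fin n) = (σ i, σ i) := rfl
    rw [h'] at h
    simp [h]

end Summit.ValiantsHypothesis.ValiantsHypothesis.Cruxes.RestorationQP.DivisionCensus
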